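import Summits.QuantumFields.YangMills.Theorems.ColdStartUniversalityLindebergSwapIrregularNull
import Summits.QuantumFields.YangMills.Theorems.ColdStartUniversalityLindebergSwapColdWindow
import Summits.QuantumFields.YangMills.Theorems.TransportPerturbationSolutionFamily
import HarnessLib

/-!
# Crux `ColdStartContinuumCauchy` (stmt-QuantumFields-24810, route `ColdStartUniversality`), LINE 3 «lindeberg_swap»:
# THE HAAR REGIME — DOMINATED CONVERGENCE OF THE TWO SMEARS AGAINST `Haar^{⊗E}`

Helper file (seat `ym-line-csu-p1`, g9; `--supports stmt-QuantumFields-24810`).  Brick (v2) of the proof plan (v4) for the registered rung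
`stub_shortWindowSwap`: the regime `t₀ ≥ ε' t₁` of the assembly, where the law of the fine process has a bounded density against the
product Haar measure (`map_le_smul_haar_of_le`).  For a coarse solution family `V` and a fine one `V'` put
`m_h(x) := E wdisc_K(V x_h, x)` and `ψ_{h'}(y) := E wdisc_K(stepDown (V' y_{h'}), stepDown y)` (both in `[0, 4]`).  We prove:

* `tendsto_integral_of_tendsto_weight` — if a bounded measurable weight `g ≥ 0` tends to `0` at `x`, then `E g(U_h) → 0` as `h → 0⁺`
  for every SZZ solution `U` from `x` (uniform stochastic continuity `measureReal_hsDist_start_ge_le`);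
* `integral_comp_eq_of_start` — `E g(U_h)` depends only on the start (uniqueness in law, `lawUnique_of_start`);
* `measurable_integral_family` — `x ↦ E f(V x_t, x)` is measurable for a jointly measurable family (Fubini measurability);
* `integral_smear_pi_haar_le` — THE HAAR REGIME: for every `η > 0` there is `h₀ > 0` such that for ALL coarse/fine solution families and
  all `h, h' ≤ h₀`, `∫ (ψ_{h'}(y) + m_h(stepDown y)) dHaar^{⊗E'}(y) ≤ η`.  Proof: `Haar^{⊗E'}`-a.e. `y` is regular
  (`ae_pi_haar_stepDown_regular`: `stepDown` continuous at `y`, `wdisc_K(·, stepDown y) → 0` at `stepDown y`), so both smears tend to `0`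
  pointwise a.e.; dominated convergence (bound `4`) on the probability space `Haar^{⊗E'}`; uniformity over the families by uniqueness in law
  through the reference families of `TransportPerturbation.solutionFamily_proof`.

THEOREMS ONLY, no sorry.  HONEST FRAMING: plumbing; no crux, rung or summit is proved; the Yang–Mills mass gap is NOT proved.
-/

set_option autoImplicit false

noncomputable section

namespace Summit.QuantumFields.YangMills.Cruxes.ColdStartContinuumCauchy.LindebergSwap

open scoped BigOperators Topology NNReal ENNReal
open MeasureTheory Filter Set Function
open Literature.MathematicalPhysics.QuantumFieldTheory
open Literature.MathematicalPhysics.QuantumFieldTheory.Balaban1983to89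
open Literature.MathematicalPhysics.QuantumLattice

variable (F : T3ContinuumYM3Torus.T3Family)

/-! ## §1 Pointwise convergence of a smear at a continuity point of the weight -/

/-- **Smears of a vanishing weight vanish**: if `g : SU(2)^E → [0, M]` is measurable and `g → 0` at `x`, then for every SZZ solution `U`
started at `x` (any probability space), `E g(U_h) → 0` as `h → 0` — uniform stochastic continuity in probability plus the `M`-tail.
[cite: RevuzYor1999, Ch. IX Thm (1.7)] [folklore] -/
theorem tendsto_integral_of_tendsto_weight {N : ℕ} [NeZero N] (β : ℝ) (x : GaugeConfig 3 N G2)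
    {Ω : Type} [MeasurableSpace Ω] {P : Measure Ω} [IsProbabilityMeasure P]
    {W : ℝ≥0 → Ω → (Edge 3 N × NoiseIdx 2 → ℝ)} (hW : IsFlatBrownian W P)
    {U : ℝ≥0 → Ω → GaugeConfig 3 N G2} (hU0 : ∀ ω, U 0 ω = x)
    (hU : (latticeLangevinDynamics (fundamentalLatticeRep 2) β).IsSolution (fundamentalRep (Fin 2)) hW.natFiltration P W U)
    {g : GaugeConfig 3 N G2 → ℝ} (hgm : Measurable g) (hg0 : ∀ z, 0 ≤ g z) {M : ℝ} (hgM : ∀ z, g z ≤ M)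
    (hgx : Tendsto g (𝓝 x) (𝓝 0)) :
    Tendsto (fun h : ℝ≥0 => ∫ ω, g (U h ω) ∂P) (𝓝 0) (𝓝 0) := by
  haveI := Summit.QuantumFields.YangMills.Theorems.ColdStartUniversality.secondCountableTopology_su2
  haveI := Summit.QuantumFields.YangMills.Theorems.ColdStartUniversality.borelSpace_config N
  obtain ⟨C, hC0, hC⟩ :=
    Summit.QuantumFields.YangMills.Theorems.ColdStartUniversality.measureReal_hsDist_start_ge_le N β
  have hM : 0 ≤ M := (hg0 x).trans (hgM x)
  have hdm : Measurable fun z : GaugeConfig 3 N G2 => ∑ e, hsForm 2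
      ((fundamentalRep (Fin 2) (z e) : Matrix (Fin 2) (Fin 2) ℂ) - fundamentalRep (Fin 2) (x e))
      ((fundamentalRep (Fin 2) (z e) : Matrix (Fin 2) (Fin 2) ℂ) - fundamentalRep (Fin 2) (x e)) :=
    (Summit.QuantumFields.YangMills.Theorems.ColdStartUniversality.continuous_hsDist continuous_id
      (continuous_const (y := x))).measurable
  rw [tendsto_order]
  refine ⟨fun a ha => Eventually.of_forall fun h => lt_of_lt_of_le ha (integral_nonneg fun ω => hg0 _),
    fun b hb => ?_⟩
  -- the weight is `< b/2` on a `D`-ball around `x`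
  have hev : ∀ᶠ z in 𝓝 x, g z < b / 2 := (tendsto_order.1 hgx).2 _ (half_pos hb)
  obtain ⟨O, hOsub, hO, hxO⟩ := mem_nhds_iff.1 hev
  obtain ⟨ρ, hρ, hball⟩ := exists_hsDist_lt_subset hO hxO
  have hsmall : ∀ z : GaugeConfig 3 N G2,
      (∑ e, hsForm 2 ((fundamentalRep (Fin 2) (z e) : Matrix (Fin 2) (Fin 2) ℂ) - fundamentalRep (Fin 2) (x e))
          ((fundamentalRep (Fin 2) (z e) : Matrix (Fin 2) (Fin 2) ℂ) - fundamentalRep (Fin 2) (x e))) < ρ → g z < b / 2 :=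
    fun z hz => hOsub (hball z hz)
  -- the tail rate tends to zero
  have hcont : Continuous fun h : ℝ≥0 => M * (C * (((h : ℝ) ^ 2) + h) / ρ) :=
    continuous_const.mul ((continuous_const.mul ((NNReal.continuous_coe.pow 2).add NNReal.continuous_coe)).div_const _)
  have hrate : Tendsto (fun h : ℝ≥0 => M * (C * (((h : ℝ) ^ 2) + h) / ρ)) (𝓝 0) (𝓝 0) := by
    have h0 := hcont.tendsto 0
    simpa using h0
  filter_upwards [(tendsto_order.1 hrate).2 _ (half_pos hb)] with h hh
  have hmU : Measurable (U h) := (hU.adapted h).mono (hW.natFiltration.le h) le_rfl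
  have hE := integral_le_add_mul_measureReal (P := P) hmU hgm hdm hg0 hgM (half_pos hb).le hsmall
  have hT := hC x Ω P W hW U hU0 hU h ρ hρ
  calc ∫ ω, g (U h ω) ∂P ≤ b / 2 + M * P.real {ω | ρ ≤ ∑ e, hsForm 2
        ((fundamentalRep (Fin 2) (U h ω e) : Matrix (Fin 2) (Fin 2) ℂ) - fundamentalRep (Fin 2) (x e))
        ((fundamentalRep (Fin 2) (U h ω e) : Matrix (Fin 2) (Fin 2) ℂ) - fundamentalRep (Fin 2) (x e))} := hE
    _ ≤ b / 2 + M * (C * (((h : ℝ) ^ 2) + h) / ρ) := by gcongr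
    _ < b := by linarith

/-! ## §2 Smears depend only on the start; measurability in the start -/

/-- **Smears depend only on the start** (uniqueness in law from a deterministic start): `E g(U_h) = E g(U'_h)` for two SZZ solutions
from the same start on any two probability spaces. [cite: RevuzYor1999, Ch. IX Thm (1.7)] -/
theorem integral_comp_eq_of_start {N : ℕ} [NeZero N] (β : ℝ) (x : GaugeConfig 3 N G2)
    {Ω : Type} [MeasurableSpace Ω] {P : Measure Ω} [IsProbabilityMeasure P]
    {W : ℝ≥0 → Ω → (Edge 3 N × NoiseIdx 2 → ℝ)} (hW : IsFlatBrownian W P)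
    {U : ℝ≥0 → Ω → GaugeConfig 3 N G2} (hU0 : ∀ ω, U 0 ω = x)
    (hU : (latticeLangevinDynamics (fundamentalLatticeRep 2) β).IsSolution (fundamentalRep (Fin 2)) hW.natFiltration P W U)
    {Ω' : Type} [MeasurableSpace Ω'] {P' : Measure Ω'} [IsProbabilityMeasure P']
    {W' : ℝ≥0 → Ω' → (Edge 3 N × NoiseIdx 2 → ℝ)} (hW' : IsFlatBrownian W' P')
    {U' : ℝ≥0 → Ω' → GaugeConfig 3 N G2} (hU'0 : ∀ ω, U' 0 ω = x)
    (hU' : (latticeLangevinDynamics (fundamentalLatticeRep 2) β).IsSolution (fundamentalRep (Fin 2)) hW'.natFiltration P' W' U')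
    {g : GaugeConfig 3 N G2 → ℝ} (hgm : Measurable g) (h : ℝ≥0) :
    ∫ ω, g (U h ω) ∂P = ∫ ω, g (U' h ω) ∂P' := by
  haveI := Summit.QuantumFields.YangMills.Theorems.ColdStartUniversality.secondCountableTopology_su2
  haveI := Summit.QuantumFields.YangMills.Theorems.ColdStartUniversality.borelSpace_config N
  have hmU : Measurable (U h) := (hU.adapted h).mono (hW.natFiltration.le h) le_rfl
  have hmU' : Measurable (U' h) := (hU'.adapted h).mono (hW'.natFiltration.le h) le_rfl
  have hlaw := Summit.QuantumFields.YangMills.Theorems.ColdStartUniversality.lawUnique_of_start β x hW hW' hU0 hU hU'0 hU' h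
  rw [← integral_map hmU.aemeasurable hgm.aestronglyMeasurable, ← integral_map hmU'.aemeasurable hgm.aestronglyMeasurable, hlaw]

/-- **Fubini measurability of a smear in the start** for a jointly measurable family. [folklore] -/
theorem measurable_integral_family {N : ℕ} {Ω : Type} [MeasurableSpace Ω] (P : Measure Ω) [SFinite P]
    {V : GaugeConfig 3 N G2 → ℝ≥0 → Ω → GaugeConfig 3 N G2} {t : ℝ≥0}
    (hV : Measurable fun p : GaugeConfig 3 N G2 × Ω => V p.1 t p.2)
    {f : GaugeConfig 3 N G2 → GaugeConfig 3 N G2 → ℝ} (hf : Measurable fun p : GaugeConfig 3 N G2 × GaugeConfig 3 N G2 => f p.1 p.2) :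
    Measurable fun x => ∫ ω, f (V x t ω) x ∂P := by
  have hm0 := hf.comp (hV.prodMk measurable_fst)
  have hm : Measurable (Function.uncurry fun (x : GaugeConfig 3 N G2) (ω : Ω) => f (V x t ω) x) := hm0
  exact (hm.stronglyMeasurable.integral_prod_right (ν := P)).measurable

/-! ## §3 The Haar regime -/

/-- **THE HAAR REGIME** (brick (v2) of the rung plan): for every `η > 0` there is `h₀ > 0` such that for EVERY coarse solution family `V`,
EVERY fine solution family `V'` (any probability spaces) and all lattice times `h, h' ≤ h₀`,
`∫ ( E wdisc_K(stepDown (V' y_{h'}), stepDown y) + E wdisc_K(V (stepDown y)_h, stepDown y) ) dHaar^{⊗E'}(y) ≤ η`.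
Dominated convergence on `Haar^{⊗E'}` (bound `4 + 4`), pointwise convergence at `Haar^{⊗E'}`-a.e. (regular) `y`, uniformity over
the families by uniqueness in law. [cite: Balaban1987RG1, (0.4) p.253] [cite: RevuzYor1999, Ch. IX Thm (1.7)] -/
theorem integral_smear_pi_haar_le (γ : ℝ) (hγ : 0 < γ) (K : ℕ) {η : ℝ} (hη : 0 < η) :
    ∃ h₀ : ℝ≥0, 0 < h₀ ∧
      ∀ (Ω₂ : Type) (_ : MeasurableSpace Ω₂) (P₂ : Measure Ω₂) (_ : IsProbabilityMeasure P₂)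
        (W₂ : ℝ≥0 → Ω₂ → (Edge 3 ((F.P K).sitesPerDir 0) × NoiseIdx 2 → ℝ)) (hW₂ : IsFlatBrownian W₂ P₂)
        (V : GaugeConfig 3 ((F.P K).sitesPerDir 0) G2 → ℝ≥0 → Ω₂ → GaugeConfig 3 ((F.P K).sitesPerDir 0) G2),
        IsSolFamily F γ K P₂ W₂ hW₂ V →
      ∀ (Ω₃ : Type) (_ : MeasurableSpace Ω₃) (P₃ : Measure Ω₃) (_ : IsProbabilityMeasure P₃)
        (W₃ : ℝ≥0 → Ω₃ → (Edge 3 ((F.P (K + 1)).sitesPerDir 0) × NoiseIdx 2 → ℝ)) (hW₃ : IsFlatBrownian W₃ P₃)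
        (V' : GaugeConfig 3 ((F.P (K + 1)).sitesPerDir 0) G2 → ℝ≥0 → Ω₃ → GaugeConfig 3 ((F.P (K + 1)).sitesPerDir 0) G2),
        IsSolFamily F γ (K + 1) P₃ W₃ hW₃ V' →
      ∀ h h' : ℝ≥0, h ≤ h₀ → h' ≤ h₀ →
        ∫ y, ((∫ ω, wdisc F K (stepDown F K (V' y h' ω)) (stepDown F K y) ∂P₃) +
              ∫ ω, wdisc F K (V (stepDown F K y) h ω) (stepDown F K y) ∂P₂)
          ∂(Measure.pi fun _ : Edge 3 ((F.P (K + 1)).sitesPerDir 0) => (HaarData.haar : Measure G2)) ≤ η := by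
  classical
  haveI := Summit.QuantumFields.YangMills.Theorems.ColdStartUniversality.secondCountableTopology_su2
  haveI := Summit.QuantumFields.YangMills.Theorems.ColdStartUniversality.borelSpace_config ((F.P K).sitesPerDir 0)
  haveI := Summit.QuantumFields.YangMills.Theorems.ColdStartUniversality.borelSpace_config ((F.P (K + 1)).sitesPerDir 0)
  -- reference families (Kunita's jointly measurable versions on the product Wiener space)
  obtain ⟨Ω₀, mΩ₀, P₀, hP₀, W₀, hW₀, V₀, hV₀, hV₀m⟩ :=
    Summit.QuantumFields.YangMills.Theorems.TransportPerturbation.solutionFamily_proof F γ hγ K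
  obtain ⟨Ω₁, mΩ₁, P₁, hP₁, W₁, hW₁, V₁, hV₁, hV₁m⟩ :=
    Summit.QuantumFields.YangMills.Theorems.TransportPerturbation.solutionFamily_proof F γ hγ (K + 1)
  -- the two reference smears
  obtain ⟨m, hmdef⟩ : ∃ m : ℝ≥0 → GaugeConfig 3 ((F.P K).sitesPerDir 0) G2 → ℝ,
      m = fun h x => ∫ ω, wdisc F K (V₀ x h ω) x ∂P₀ := ⟨_, rfl⟩
  obtain ⟨ψ, hψdef⟩ : ∃ ψ : ℝ≥0 → GaugeConfig 3 ((F.P (K + 1)).sitesPerDir 0) G2 → ℝ,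
      ψ = fun h' y => ∫ ω, wdisc F K (stepDown F K (V₁ y h' ω)) (stepDown F K y) ∂P₁ := ⟨_, rfl⟩
  -- measurability of the weights and of the smears
  have hwm : Measurable fun p : GaugeConfig 3 ((F.P K).sitesPerDir 0) G2 × GaugeConfig 3 ((F.P K).sitesPerDir 0) G2 =>
      wdisc F K p.1 p.2 := measurable_wdisc' F K
  have hwm'0 := (measurable_wdisc' F K).comp
    (((measurable_stepDown F K).comp measurable_fst).prodMk ((measurable_stepDown F K).comp measurable_snd) :
      Measurable fun p : GaugeConfig 3 ((F.P (K + 1)).sitesPerDir 0) G2 × GaugeConfig 3 ((F.P (K + 1)).sitesPerDir 0) G2 =>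
        (stepDown F K p.1, stepDown F K p.2))
  have hwm' : Measurable fun p : GaugeConfig 3 ((F.P (K + 1)).sitesPerDir 0) G2 × GaugeConfig 3 ((F.P (K + 1)).sitesPerDir 0) G2 =>
      wdisc F K (stepDown F K p.1) (stepDown F K p.2) := hwm'0
  have hm_meas : ∀ h, Measurable (m h) := fun h => by
    rw [hmdef]; exact measurable_integral_family P₀ (hV₀m h) hwm
  have hψ_meas : ∀ h', Measurable (ψ h') := fun h' => by
    rw [hψdef]
    exact measurable_integral_family P₁ (hV₁m h') (f := fun a b => wdisc F K (stepDown F K a) (stepDown F K b)) hwm'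
  -- bounds `0 ≤ · ≤ 4`
  have hint4 : ∀ {Ω : Type} [MeasurableSpace Ω] (P : Measure Ω) [IsProbabilityMeasure P] (f : Ω → ℝ),
      (∀ ω, 0 ≤ f ω) → (∀ ω, f ω ≤ 4) → 0 ≤ ∫ ω, f ω ∂P ∧ ∫ ω, f ω ∂P ≤ 4 := by
    intro Ω _ P _ f h0 h4
    refine ⟨integral_nonneg h0, ?_⟩
    have h := integral_mono_of_nonneg (μ := P) (Eventually.of_forall h0) (integrable_const (4 : ℝ)) (Eventually.of_forall h4)
    simpa using h
  have hm_bd : ∀ h x, 0 ≤ m h x ∧ m h x ≤ 4 := fun h x => by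
    rw [hmdef]
    exact hint4 P₀ _ (fun ω => (wdisc_nonneg_le_four F K _ _).1) (fun ω => (wdisc_nonneg_le_four F K _ _).2)
  have hψ_bd : ∀ h' y, 0 ≤ ψ h' y ∧ ψ h' y ≤ 4 := fun h' y => by
    rw [hψdef]
    exact hint4 P₁ _ (fun ω => (wdisc_nonneg_le_four F K _ _).1) (fun ω => (wdisc_nonneg_le_four F K _ _).2)
  -- pointwise convergence at every regular (hence a.e.) fine configuration
  have hlim : ∀ᵐ y ∂(Measure.pi fun _ : Edge 3 ((F.P (K + 1)).sitesPerDir 0) => (HaarData.haar : Measure G2)),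
      Tendsto (fun h => m h (stepDown F K y)) (𝓝 0) (𝓝 0) ∧ Tendsto (fun h' => ψ h' y) (𝓝 0) (𝓝 0) := by
    filter_upwards [ae_pi_haar_stepDown_regular F K] with y hy
    obtain ⟨hSDy, hwd⟩ := hy
    have hg0 := (measurable_wdisc' F K).comp
      (measurable_id.prodMk (measurable_const (β := GaugeConfig 3 ((F.P K).sitesPerDir 0) G2) (a := stepDown F K y)))
    have hg : Measurable fun u : GaugeConfig 3 ((F.P K).sitesPerDir 0) G2 => wdisc F K u (stepDown F K y) := hg0
    have hg'0 := (measurable_wdisc' F K).comp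
      ((measurable_stepDown F K).prodMk
        (measurable_const (β := GaugeConfig 3 ((F.P (K + 1)).sitesPerDir 0) G2) (a := stepDown F K y)))
    have hg' : Measurable fun z : GaugeConfig 3 ((F.P (K + 1)).sitesPerDir 0) G2 => wdisc F K (stepDown F K z) (stepDown F K y) :=
      hg'0
    refine ⟨?_, ?_⟩
    · rw [hmdef]
      exact tendsto_integral_of_tendsto_weight ((γ * (F.P K).eps)⁻¹ / 2) (stepDown F K y) hW₀ (hV₀ _).1 (hV₀ _).2 hg
        (fun z => (wdisc_nonneg_le_four F K _ _).1) (fun z => (wdisc_nonneg_le_four F K _ _).2) hwd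
    · rw [hψdef]
      exact tendsto_integral_of_tendsto_weight ((γ * (F.P (K + 1)).eps)⁻¹ / 2) y hW₁ (hV₁ y).1 (hV₁ y).2 hg'
        (fun z => (wdisc_nonneg_le_four F K _ _).1) (fun z => (wdisc_nonneg_le_four F K _ _).2) (hwd.comp hSDy)
  -- dominated convergence on the probability space `Haar^{⊗E'}`, twice
  have hDm : Tendsto (fun h => ∫ y, m h (stepDown F K y)
      ∂(Measure.pi fun _ : Edge 3 ((F.P (K + 1)).sitesPerDir 0) => (HaarData.haar : Measure G2))) (𝓝 0) (𝓝 0) := by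
    have h := tendsto_integral_filter_of_dominated_convergence
      (μ := Measure.pi fun _ : Edge 3 ((F.P (K + 1)).sitesPerDir 0) => (HaarData.haar : Measure G2))
      (l := 𝓝 (0 : ℝ≥0)) (F := fun h y => m h (stepDown F K y)) (f := fun _ => (0 : ℝ)) (fun _ => (4 : ℝ))
      (Eventually.of_forall fun h => ((hm_meas h).comp (measurable_stepDown F K)).aestronglyMeasurable)
      (Eventually.of_forall fun h => Eventually.of_forall fun y => by
        rw [Real.norm_eq_abs, abs_of_nonneg (hm_bd _ _).1]; exact (hm_bd _ _).2)
      (integrable_const _) (by filter_upwards [hlim] with y hy using hy.1)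
    simpa using h
  have hDψ : Tendsto (fun h' => ∫ y, ψ h' y
      ∂(Measure.pi fun _ : Edge 3 ((F.P (K + 1)).sitesPerDir 0) => (HaarData.haar : Measure G2))) (𝓝 0) (𝓝 0) := by
    have h := tendsto_integral_filter_of_dominated_convergence
      (μ := Measure.pi fun _ : Edge 3 ((F.P (K + 1)).sitesPerDir 0) => (HaarData.haar : Measure G2))
      (l := 𝓝 (0 : ℝ≥0)) (F := fun h' y => ψ h' y) (f := fun _ => (0 : ℝ)) (fun _ => (4 : ℝ))
      (Eventually.of_forall fun h' => (hψ_meas h').aestronglyMeasurable)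
      (Eventually.of_forall fun h' => Eventually.of_forall fun y => by
        rw [Real.norm_eq_abs, abs_of_nonneg (hψ_bd _ _).1]; exact (hψ_bd _ _).2)
      (integrable_const _) (by filter_upwards [hlim] with y hy using hy.2)
    simpa using h
  -- the threshold `h₀`
  have hev : ∀ᶠ h in 𝓝 (0 : ℝ≥0),
      (∫ y, m h (stepDown F K y) ∂(Measure.pi fun _ : Edge 3 ((F.P (K + 1)).sitesPerDir 0) => (HaarData.haar : Measure G2)))
          < η / 2 ∧
        (∫ y, ψ h y ∂(Measure.pi fun _ : Edge 3 ((F.P (K + 1)).sitesPerDir 0) => (HaarData.haar : Measure G2))) < η / 2 :=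
    ((tendsto_order.1 hDm).2 _ (half_pos hη)).and ((tendsto_order.1 hDψ).2 _ (half_pos hη))
  obtain ⟨a, ha, hA⟩ := NNReal.nhds_zero_basis.eventually_iff.1 hev
  refine ⟨a / 2, half_pos ha, ?_⟩
  intro Ω₂ mΩ₂ P₂ hP₂ W₂ hW₂ V hV Ω₃ mΩ₃ P₃ hP₃ W₃ hW₃ V' hV' h h' hh hh'
  have hha : h ∈ Iio a := lt_of_le_of_lt hh (half_lt_self ha)
  have hh'a : h' ∈ Iio a := lt_of_le_of_lt hh' (half_lt_self ha)
  -- the given families have the same smears as the reference ones (uniqueness in law), pointwise in the start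
  have hEqm : ∀ x, ∫ ω, wdisc F K (V x h ω) x ∂P₂ = m h x := fun x => by
    rw [hmdef]
    have hg0 := (measurable_wdisc' F K).comp
      (measurable_id.prodMk (measurable_const (β := GaugeConfig 3 ((F.P K).sitesPerDir 0) G2) (a := x)))
    have hg : Measurable fun u : GaugeConfig 3 ((F.P K).sitesPerDir 0) G2 => wdisc F K u x := hg0
    exact integral_comp_eq_of_start ((γ * (F.P K).eps)⁻¹ / 2) x hW₂ (hV.1 x).1 (hV.1 x).2 hW₀ (hV₀ x).1 (hV₀ x).2 hg h
  have hEqψ : ∀ y, ∫ ω, wdisc F K (stepDown F K (V' y h' ω)) (stepDown F K y) ∂P₃ = ψ h' y := fun y => by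
    rw [hψdef]
    have hg'0 := (measurable_wdisc' F K).comp
      ((measurable_stepDown F K).prodMk
        (measurable_const (β := GaugeConfig 3 ((F.P (K + 1)).sitesPerDir 0) G2) (a := stepDown F K y)))
    have hg' : Measurable fun z : GaugeConfig 3 ((F.P (K + 1)).sitesPerDir 0) G2 => wdisc F K (stepDown F K z) (stepDown F K y) :=
      hg'0
    exact integral_comp_eq_of_start ((γ * (F.P (K + 1)).eps)⁻¹ / 2) y hW₃ (hV'.1 y).1 (hV'.1 y).2 hW₁ (hV₁ y).1 (hV₁ y).2
      hg' h'
  have hfun : (fun y => (∫ ω, wdisc F K (stepDown F K (V' y h' ω)) (stepDown F K y) ∂P₃) +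
      ∫ ω, wdisc F K (V (stepDown F K y) h ω) (stepDown F K y) ∂P₂) = fun y => ψ h' y + m h (stepDown F K y) := by
    funext y; rw [hEqψ, hEqm]
  have hIψ : Integrable (fun y => ψ h' y) (Measure.pi fun _ : Edge 3 ((F.P (K + 1)).sitesPerDir 0) => (HaarData.haar : Measure G2)) :=
    (integrable_const (4 : ℝ)).mono' (hψ_meas h').aestronglyMeasurable
      (Eventually.of_forall fun y => by rw [Real.norm_eq_abs, abs_of_nonneg (hψ_bd _ _).1]; exact (hψ_bd _ _).2)
  have hIm : Integrable (fun y => m h (stepDown F K y))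
      (Measure.pi fun _ : Edge 3 ((F.P (K + 1)).sitesPerDir 0) => (HaarData.haar : Measure G2)) :=
    (integrable_const (4 : ℝ)).mono' ((hm_meas h).comp (measurable_stepDown F K)).aestronglyMeasurable
      (Eventually.of_forall fun y => by rw [Real.norm_eq_abs, abs_of_nonneg (hm_bd _ _).1]; exact (hm_bd _ _).2)
  rw [hfun, integral_add hIψ hIm]
  linarith [(hA hh'a).2, (hA hha).1]

end Summit.QuantumFields.YangMills.Cruxes.ColdStartContinuumCauchy.LindebergSwap

end
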